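import Literature.NumberTheory.Automorphic.ReciprocityGLn
import HarnessLib

/-!
# Böckle–Hui 2025, Theorem 1.2: irreducibility of `ρ_{π,ι}` for regular algebraic cuspidal `π`
# on `GL_3` over a totally real field (named fact)

Topic `NumberTheory/Automorphic`; namespace `Literature.NumberTheory.Automorphic`.

Source: G. Böckle, C.-Y. Hui, *Weak abelian direct summands and irreducibility of Galois
representations*, Math. Ann. 393 (2025) 543–569 (`arXiv:2404.08954`) [BockleHui2025]; quotations
from the held arXiv text (`paper:arxiv-2404.08954`, pp. 3–4, 13).

> **§1.2.** "Let `K` be a totally real (or CM) number field, `π` a regular algebraic cuspidal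
> automorphic representation of `GL_n(𝔸_K)`, and `ι : ℂ ≃ ℚ̄_ℓ` a field isomorphism. … Attached to
> the pair `(π, ι)` is a semisimple (conjecturally irreducible …) `ℓ`-adic representation of `K`,
> `ρ_{π,ι} : Gal_K → GL_n(ℚ̄_ℓ)` (1), that satisfies local-global compatibility away from `ℓ`: if `v`
> is a finite place of `K` outside `S_ℓ`, then
> `WD(ρ_{π,ι}|_{Gal_{K_v}})^{ss} = ι ∘ rec_{K_v}(π_v ⊗ |det|_v^{(1-n)/2})` (2). The construction of
> `ρ_{π,ι}` such that (2) holds for all `v` outside `S ∪ S_ℓ` was given by [HLTT16] (and resp.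
> [Sc15]) and the validity of (2) for all `v` outside `S_ℓ` was obtained in [Va18]."
> **Theorem 1.2.** "Let `K` be a totally real field, `π` a regular algebraic cuspidal automorphic
> representation of `GL_3(𝔸_K)`, and `ι : ℂ ≃ ℚ̄_ℓ` a field isomorphism. Then the three-dimensional
> `ℓ`-adic Galois representation (1) of `K` attached to `(π, ι)` is irreducible."
> (Proved in §3.2.1 as "Theorem (main)", by Ramakrishnan's `L`-function argument, Theorem 1.1,
> multiplicity one [JS81] and [Hu23a].)

## The statement and its faithfulness

The tree does not single out *the* representation `ρ_{π,ι}`: the existence theorem of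
Harris–Lan–Taylor–Thorne / Scholze (with Varma) is the named fact
`Literature.NumberTheory.Automorphic.exists_galoisRep_of_regularAlgebraic`, which produces *some*
continuous semisimple `r : Γ_K →ₜ* GL_n(ℚ̄_ℓ)` (`GaloisRepresentations.FramedGaloisRep`,
coefficients `PadicAlgCl ℓ`, `ι : PadicAlgCl ℓ ≃+* ℂ` explicit) that is unramified with arithmetic
Frobenius characteristic polynomial `arithFrobPolyOfSatake ι q_v n α = ∏_j (X - ι⁻¹((q_v^{(n-1)/2} α_j)⁻¹))`
at every finite `v ∤ ℓ` where `π` has Satake parameter `α` — the unramified part of (2).  Every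
statement of the tree about `ρ_{π,ι}` (lang.S27, the route `ReducibleSelfDual`) is accordingly
phrased "for every semisimple `r` with this compatibility".  This is equivalent to the statement
about `ρ_{π,ι}`: `π` has Satake parameters at all but finitely many places
(`AutomorphicRepData.hasSatakeParamAt_cofinite_holds`, proved in the tree), so any such `r` has the
same Frobenius characteristic polynomials as `ρ_{π,ι}` on a cofinite set of places, hence is
equivalent to it (both being semisimple: Chebotarev and Brauer–Nesbitt, the tree's
`GaloisRepresentations.FramedGaloisRep.nonempty_equiv_of_hasFrobCharpolyAt_eventually`), and
irreducibility is invariant under equivalence.  The fact below is therefore Theorem 1.2 as printed,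
transported along this (standard, in-tree) identification; nothing is added or weakened: `K`
totally real (`NumberField.IsTotallyReal`), `n = 3`, `π` cuspidal (`CuspidalAutomorphicRepData`)
and regular algebraic (`IsRegularAlgebraic`), every prime `ℓ` and every `ι`.  Irreducibility is
the tree's `ContinuousRep.IsIrreducible` of `r.toGaloisRep` (Mathlib `Representation.IsIrreducible`
of the underlying representation on `ℚ̄_ℓ³`, i.e. no proper non-zero invariant subspace — over the
algebraically closed field `ℚ̄_ℓ` this is absolute irreducibility, as in the source).  The
compactness proof `hcpt : isCompact_glFiniteIntegralLevel 3 K` needed to *type* `π` is threaded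
as in `exists_galoisRep_of_regularAlgebraic` (D-0014).  The CM case is NOT asserted (it is open;
BH prove the totally real case only).

## References

* G. Böckle, C.-Y. Hui, Math. Ann. 393 (2025), Thm. 1.2 (= Theorem "main" of §3.2.1), §1.2.
  [BockleHui2025]
* M. Harris, K.-W. Lan, R. Taylor, J. Thorne, *On the rigid cohomology of certain Shimura
  varieties*, Res. Math. Sci. 3 (2016), Thm. A (existence of `ρ_{π,ι}`). [HarrisLanTaylorThorneRMS2016]
-/

noncomputable section

open scoped NumberField
open NumberField IsDedekindDomain

namespace Literature.NumberTheory.Automorphic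

/-- **Böckle–Hui 2025, Theorem 1.2 (irreducibility for regular algebraic cuspidal `π` on `GL_3`
over totally real fields).**  Let `K` be a totally real number field, `π` a regular algebraic
cuspidal automorphic representation of `GL_3(𝔸_K)`, `ℓ` a prime and `ι : ℚ̄_ℓ ≃+* ℂ`.  Then every
continuous semisimple `r : Γ_K →ₜ* GL_3(ℚ̄_ℓ)` satisfying unramified local–global compatibility
with `(π, ι)` — at every finite `v ∤ ℓ` where `π` has Satake parameter `α`, `r` is unramified at
`v` with arithmetic-Frobenius characteristic polynomial `arithFrobPolyOfSatake ι q_v 3 α` (the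
normalisation of `exists_galoisRep_of_regularAlgebraic`, lang.S27) — is irreducible
(`r.toGaloisRep.IsIrreducible`).  Such `r` are exactly the representations equivalent to
`ρ_{π,ι}` (module docstring), so this is the printed theorem: "Let `K` be a totally real field, `π`
a regular algebraic cuspidal automorphic representation of `GL_3(𝔸_K)`, and `ι : ℂ ≃ ℚ̄_ℓ` a field
isomorphism. Then the three-dimensional `ℓ`-adic Galois representation of `K` attached to `(π, ι)`
is irreducible."  Named fact (D-0014); `hcpt` threaded. [cite: BockleHui2025, Theorem 1.2] -/
def isIrreducible_galoisRep_gl3_totallyReal : Prop :=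
  ∀ (K : Type) [Field K] [NumberField K], IsTotallyReal K →
    ∀ (hcpt : isCompact_glFiniteIntegralLevel 3 K) (π : CuspidalAutomorphicRepData 3 K hcpt),
      π.1.IsRegularAlgebraic → ∀ (ℓ : ℕ) [Fact ℓ.Prime] (ι : PadicAlgCl ℓ ≃+* ℂ)
        (r : GaloisRepresentations.FramedGaloisRep K (PadicAlgCl ℓ) 3), r.toGaloisRep.IsSemisimple →
        (∀ (v : HeightOneSpectrum (𝓞 K)) (α : Multiset ℂ), π.1.HasSatakeParamAt v α →
            ((ℓ : ℕ) : 𝓞 K) ∉ v.asIdeal →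
              r.IsUnramifiedAt v ∧ r.HasFrobCharpolyAt v (arithFrobPolyOfSatake ι v.residueCard 3 α)) →
        r.toGaloisRep.IsIrreducible

/-- Unfolding lemma for `isIrreducible_galoisRep_gl3_totallyReal`. [folklore] -/
theorem isIrreducible_galoisRep_gl3_totallyReal_iff :
    isIrreducible_galoisRep_gl3_totallyReal ↔
      ∀ (K : Type) [Field K] [NumberField K], IsTotallyReal K →
        ∀ (hcpt : isCompact_glFiniteIntegralLevel 3 K) (π : CuspidalAutomorphicRepData 3 K hcpt),
          π.1.IsRegularAlgebraic → ∀ (ℓ : ℕ) [Fact ℓ.Prime] (ι : PadicAlgCl ℓ ≃+* ℂ)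
            (r : GaloisRepresentations.FramedGaloisRep K (PadicAlgCl ℓ) 3),
            r.toGaloisRep.IsSemisimple →
            (∀ (v : HeightOneSpectrum (𝓞 K)) (α : Multiset ℂ), π.1.HasSatakeParamAt v α →
                ((ℓ : ℕ) : 𝓞 K) ∉ v.asIdeal →
                  r.IsUnramifiedAt v ∧
                    r.HasFrobCharpolyAt v (arithFrobPolyOfSatake ι v.residueCard 3 α)) →
            r.toGaloisRep.IsIrreducible :=
  Iff.rfl

/-- **Existence form.**  Granting Theorem 1.2 and the existence of `ρ_{π,ι}`
(`exists_galoisRep_of_regularAlgebraic`, Harris–Lan–Taylor–Thorne / Scholze): for `K` totally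
real and `π` regular algebraic cuspidal on `GL_3(𝔸_K)` there is, for every `ℓ` and `ι`, an
**irreducible** continuous `r : Γ_K →ₜ* GL_3(ℚ̄_ℓ)` with the unramified compatibility of lang.S27.
[cite: BockleHui2025, Theorem 1.2] -/
theorem exists_isIrreducible_galoisRep_gl3_totallyReal (h : isIrreducible_galoisRep_gl3_totallyReal)
    (hex : exists_galoisRep_of_regularAlgebraic) {K : Type} [Field K] [NumberField K]
    (hK : IsTotallyReal K) (hcpt : isCompact_glFiniteIntegralLevel 3 K)
    (π : CuspidalAutomorphicRepData 3 K hcpt) (hπ : π.1.IsRegularAlgebraic) (ℓ : ℕ) [Fact ℓ.Prime]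
    (ι : PadicAlgCl ℓ ≃+* ℂ) :
    ∃ r : GaloisRepresentations.FramedGaloisRep K (PadicAlgCl ℓ) 3,
      r.toGaloisRep.IsIrreducible ∧ r.toGaloisRep.IsSemisimple ∧
        ∀ (v : HeightOneSpectrum (𝓞 K)) (α : Multiset ℂ), π.1.HasSatakeParamAt v α →
          ((ℓ : ℕ) : 𝓞 K) ∉ v.asIdeal →
            r.IsUnramifiedAt v ∧ r.HasFrobCharpolyAt v (arithFrobPolyOfSatake ι v.residueCard 3 α) := by
  obtain ⟨r, hss, hr⟩ := hex hcpt (Or.inl hK) π hπ ℓ ι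
  exact ⟨r, h K hK hcpt π hπ ℓ ι r hss hr, hss, hr⟩

end Literature.NumberTheory.Automorphic
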